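import Literature.Computability.Complexity.UnaryExprBricks
import HarnessLib

/-!
# One-way functions ⇒ UOWHF, machine layer I: the parameter table

Topic `Literature/Computability/Cryptography`; ninth file of the "one-way functions ⇒ universal one-way
hash functions" line (Rompel 1990 = Goldreich 2004, Thm. 6.4.29, via Haitner–Holenstein–Reingold–Vadhan–
Wee, *Inaccessible Entropy II*, Theory of Computing 16(8), 2020, Thm. 4.5 + Thm. 5.1; combinatorial layer
in `InaccessibleEntropy{PrefixHash,Product,Hashing,UOWHF,UOWHFBound}.lean`, `UOWHFCombiners.lean`,
`AffineHashThreewise.lean`). The machine layer realises the construction of the proof of Thm. 5.1 for a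
length-preserving one-way function `f` on `{0,1}ⁿ` as polynomial-time string functions. This file fixes
the **sizes** of all blocks as functions of `n`, twice: as natural-number functions (`HHRVW.Sz.*`, used by
the analysis) and as size expressions (`HHRVW.Sz.E.*`, `UExpr` of `UnaryExprBricks.lean`, compiled into
the `FP` bricks of the evaluator and of the inverter), with the `simp` bridge `E.*_eval` and the
arithmetic the later files rely on.

The choices (HHRVW 2020, §4.2 and proof of Thm. 5.1, with the integrality conventions of this
formalisation): `a = |bin n|`, `M = 2^a` (the range of the prefix length `i`, and the number `k` of output
bits of the row hash; `T = M`, so `log T = a` and the entropy gap is `Δ = a/(12M) ≥ Δ' := a/(16M)`);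
`ℓK = M(n+1)` key bits of the affine hash `{0,1}ⁿ → {0,1}^M`; `d₀ = n + ℓK + a` bits for a point
`(x, κ, i)` of the domain of the base function; `t = 128·M·2^{|bin X|}` repetitions with `X = 32·n·d₀²·M`
(a power of two, `t = 2^{logt}`, at least `4096·n·d₀²·M²`, a multiple of `128M`); `u = a·2^{|bin X|} = t·a/(128M)`
(the unit in which the grid quantities are integers: for grid index `j`, `k_j = jΔ'/4` and the output length
of the entropy-smoothing hash is `ℓ_j = ⌊t(k_j − Δ'/2)⌋ − tΔ'/8 = u(2j − 5)`); `J + 1 = 2^{|bin(64·M·d₀)|}` grid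
points; `ℓmax = 2u(J+1)`; `|G₂| = ℓmax(t·d₀ + 1)` key bits of the smoothing hash; `blk = M + ℓK + a` bits per
output block of `F₁ = Fᵗ`; `m₂ = t·blk + |G₂| + ℓmax` bits of output of `F₂`; `n₂ = t·d₀ + |G₂|` bits of input
of `F₂`, `r₃ = n₂ − 1` output bits of the final hash, `|G₃| = r₃(m₂ + 1)` its key bits; a candidate maps
`N = n₂ + |G₃|` bits to `N − 1`; chaining `R = J(N − 1)` one-bit extensions gives input length `d = N + R`
and, concatenating the `J + 1` candidates, output length `(J+1)(N−1) = d − 1`; the key has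
`K = (J+1)(R+1)N` bits and the index `kLen = n + 1 + K` symbols (`1ⁿ 0` followed by the key bits).

All statements proved; no named facts, no machines yet.

## References

* I. Haitner, T. Holenstein, O. Reingold, S. Vadhan, H. Wee, *Inaccessible Entropy II: IE Functions and
  Universal One-Way Hashing*, Theory of Computing 16(8) (2020), §4.2 (Thm. 4.5: parameters `c`, `λ`, `Δ`),
  proof of Thm. 5.1 (Steps 1–5: `t`, `ℓ`, the grid of `k`), Lemma 5.7.
* O. Goldreich, *Foundations of Cryptography II*, CUP 2004, §6.4.3.2 (Def. 6.4.19, Thm. 6.4.29).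
-/

namespace Literature.Computability.Complexity.UExpr

open _root_.Computability Polynomial

/-- **Size expressions are polynomially bounded**: if every variable is at most `m`, the value is at
most `p(m)` for a polynomial `p` (with natural coefficients, hence monotone) depending only on the
expression. [folklore] -/
theorem exists_poly_le : ∀ e : UExpr, ∃ p : Polynomial ℕ, ∀ (ρ : ℕ → ℕ) (m : ℕ), (∀ i, ρ i ≤ m) → eval ρ e ≤ p.eval m
  | var i => ⟨X, fun ρ m h => by simpa using h i⟩
  | cst c => ⟨C c, fun ρ m _ => by simp⟩
  | add e₁ e₂ => by
    obtain ⟨p₁, h₁⟩ := exists_poly_le e₁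
    obtain ⟨p₂, h₂⟩ := exists_poly_le e₂
    exact ⟨p₁ + p₂, fun ρ m h => by rw [eval_add, Polynomial.eval_add]; exact Nat.add_le_add (h₁ ρ m h) (h₂ ρ m h)⟩
  | mul e₁ e₂ => by
    obtain ⟨p₁, h₁⟩ := exists_poly_le e₁
    obtain ⟨p₂, h₂⟩ := exists_poly_le e₂
    exact ⟨p₁ * p₂, fun ρ m h => by rw [eval_mul, Polynomial.eval_mul]; exact Nat.mul_le_mul (h₁ ρ m h) (h₂ ρ m h)⟩
  | sub e₁ e₂ => by
    obtain ⟨p₁, h₁⟩ := exists_poly_le e₁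
    exact ⟨p₁, fun ρ m h => by rw [eval_sub]; exact (Nat.sub_le _ _).trans (h₁ ρ m h)⟩
  | blen e => by
    obtain ⟨p, hp⟩ := exists_poly_le e
    exact ⟨p, fun ρ m h => (blen_le ρ e).trans (hp ρ m h)⟩
  | pow2 e => by
    obtain ⟨p, hp⟩ := exists_poly_le e
    exact ⟨C 2 * p + C 1, fun ρ m h => by
      have := pow2_le ρ e
      have := hp ρ m h
      simp only [Polynomial.eval_add, Polynomial.eval_mul, Polynomial.eval_C]
      omega⟩

/-- One-variable form: a polynomial bound in `n` for the environment `fun _ => n`. [folklore] -/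
theorem exists_poly_le₁ (e : UExpr) : ∃ p : Polynomial ℕ, ∀ n : ℕ, eval (fun _ => n) e ≤ p.eval n := by
  obtain ⟨p, hp⟩ := exists_poly_le e
  exact ⟨p, fun n => hp _ n fun _ => le_rfl⟩

end Literature.Computability.Complexity.UExpr

namespace Literature.Computability.Cryptography

namespace HHRVW

namespace Sz

open _root_.Computability Literature.Computability.Complexity Literature.Computability.Complexity.UExpr

/-! ### The sizes as natural-number functions -/

/-- `a n = |bin n|`, the number of bits of the prefix length `i` and `log₂ M`. [cite: HaitnerEtAl2020, §4.2] -/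
def a (n : ℕ) : ℕ := (encodeNat n).length

/-- `M n = 2^{a n}`: the range of `i`, the output length `k` of the row hash, and the threshold `T`.
[cite: HaitnerEtAl2020, §4.2 (`c`, `λ`)] -/
def M (n : ℕ) : ℕ := 2 ^ a n

/-- `ℓK n = M (n+1)`: key bits of the affine row hash `{0,1}ⁿ → {0,1}^M`. [cite: HaitnerEtAl2020, §4.2] -/
def lK (n : ℕ) : ℕ := M n * (n + 1)

/-- `d₀ n = n + ℓK + a`: bits of a point `(x, κ, i)`. [cite: HaitnerEtAl2020, §4.2] -/
def d0 (n : ℕ) : ℕ := n + lK n + a n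

/-- `X n = 32·n·d₀²·M`, the quantity the number of repetitions must dominate. [cite: HaitnerEtAl2020, proof of Thm. 5.1, Step 1] -/
def X (n : ℕ) : ℕ := 32 * n * (d0 n * d0 n) * M n

/-- `P2X n = 2^{|bin X|} > X`. [cite: HaitnerEtAl2020, proof of Thm. 5.1, Step 1] -/
def P2X (n : ℕ) : ℕ := 2 ^ (encodeNat (X n)).length

/-- `t n = 128·M·P2X`, the number of repetitions (a power of two). [cite: HaitnerEtAl2020, proof of Thm. 5.1, Step 1] -/
def t (n : ℕ) : ℕ := 128 * M n * P2X n

/-- `logt n = 7 + a + |bin X| = log₂ t`. [cite: HaitnerEtAl2020, proof of Thm. 5.1, Step 1] -/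
def logt (n : ℕ) : ℕ := 7 + a n + (encodeNat (X n)).length

/-- `u n = a·P2X = t·a/(128 M)`, the unit of the integral grid quantities. [cite: HaitnerEtAl2020, proof of Thm. 5.1, Steps 2–3] -/
def u (n : ℕ) : ℕ := a n * P2X n

/-- `Y n = 64·M·d₀`, the number of grid points needed. [cite: HaitnerEtAl2020, proof of Thm. 5.1, Step 5] -/
def Y (n : ℕ) : ℕ := 64 * M n * d0 n

/-- `Jp1 n = 2^{|bin Y|} = J + 1`, the number of grid points (candidates). [cite: HaitnerEtAl2020, proof of Thm. 5.1, Step 5] -/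
def Jp1 (n : ℕ) : ℕ := 2 ^ (encodeNat (Y n)).length

/-- `aJ n = |bin Y| = log₂ (J+1)`. [cite: HaitnerEtAl2020, proof of Thm. 5.1, Step 5] -/
def aJ (n : ℕ) : ℕ := (encodeNat (Y n)).length

/-- `ell n j = u(2j − 5)`, the output length of the smoothing hash of candidate `j`. [cite: HaitnerEtAl2020, proof of Thm. 5.1, Step 2] -/
def ell (n j : ℕ) : ℕ := u n * (2 * j - 5)

/-- `lmax n = 2u(J+1) ≥ ell n j` for all grid `j`. [cite: HaitnerEtAl2020, proof of Thm. 5.1, Step 2] -/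
def lmax (n : ℕ) : ℕ := u n * (2 * Jp1 n)

/-- `G2 n = ℓmax(t·d₀ + 1)`: key bits of the smoothing hash. [cite: HaitnerEtAl2020, proof of Thm. 5.1, Step 2] -/
def G2 (n : ℕ) : ℕ := lmax n * (t n * d0 n + 1)

/-- `blk n = M + ℓK + a`: bits of an output block `(z, κ, i)` of the base function. [cite: HaitnerEtAl2020, §4.2] -/
def blk (n : ℕ) : ℕ := M n + lK n + a n

/-- `m2 n = t·blk + |G₂| + ℓmax`: output bits of `F₂`. [cite: HaitnerEtAl2020, proof of Thm. 5.1, Step 2] -/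
def m2 (n : ℕ) : ℕ := t n * blk n + G2 n + lmax n

/-- `n2 n = t·d₀ + |G₂|`: input bits of `F₂`. [cite: HaitnerEtAl2020, proof of Thm. 5.1, Step 2] -/
def n2 (n : ℕ) : ℕ := t n * d0 n + G2 n

/-- `r3 n = n₂ − 1`: output bits of the final hash. [cite: HaitnerEtAl2020, proof of Thm. 5.1, Step 3] -/
def r3 (n : ℕ) : ℕ := n2 n - 1

/-- `G3 n = r₃(m₂ + 1)`: key bits of the final hash. [cite: HaitnerEtAl2020, proof of Thm. 5.1, Step 3] -/
def G3 (n : ℕ) : ℕ := r3 n * (m2 n + 1)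

/-- `N n = n₂ + |G₃|`: input bits of a candidate. [cite: HaitnerEtAl2020, proof of Thm. 5.1, Step 4] -/
def N (n : ℕ) : ℕ := n2 n + G3 n

/-- `Nm1 n = r₃ + |G₃| = N − 1`: output bits of a candidate. [cite: HaitnerEtAl2020, proof of Thm. 5.1, Step 4] -/
def Nm1 (n : ℕ) : ℕ := r3 n + G3 n

/-- `d n = (J+1)(N−1) + 1`: input bits of the final family. [cite: HaitnerEtAl2020, proof of Thm. 5.1, Step 5 and Lemma 5.7] -/
def d (n : ℕ) : ℕ := Jp1 n * Nm1 n + 1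

/-- `R n = d − N = J(N−1)`: the number of one-bit chaining extensions. [cite: HaitnerEtAl2020, Lemma 5.7] -/
def R (n : ℕ) : ℕ := d n - N n

/-- `aR n = |bin R|`: coin bits for guessing a chain level. [cite: HaitnerEtAl2020, Lemma 5.7] -/
def aR (n : ℕ) : ℕ := (encodeNat (R n)).length

/-- `K n = (J+1)(R+1)N`: key bits of the final family. [cite: HaitnerEtAl2020, proof of Thm. 5.1, Step 5] -/
def K (n : ℕ) : ℕ := Jp1 n * (R n + 1) * N n

/-- `kLen n = n + 1 + K`: symbols of an index `1ⁿ 0 key`. [cite: HaitnerEtAl2020, proof of Thm. 5.1] -/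
def kLen (n : ℕ) : ℕ := n + 1 + K n

/-! ### The same sizes as size expressions (`var 0 = n`, `var 1 = j`) -/

namespace E

/-- `a`. [cite: HaitnerEtAl2020, §4.2] -/
def a : UExpr := blen (var 0)
/-- `M`. [cite: HaitnerEtAl2020, §4.2] -/
def M : UExpr := pow2 (var 0)
/-- `ℓK`. [cite: HaitnerEtAl2020, §4.2] -/
def lK : UExpr := mul M (add (var 0) (cst 1))
/-- `d₀`. [cite: HaitnerEtAl2020, §4.2] -/
def d0 : UExpr := add (add (var 0) lK) a
/-- `X`. [cite: HaitnerEtAl2020, proof of Thm. 5.1] -/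
def X : UExpr := mul (mul (mul (cst 32) (var 0)) (mul d0 d0)) M
/-- `P2X`. [cite: HaitnerEtAl2020, proof of Thm. 5.1] -/
def P2X : UExpr := pow2 X
/-- `t`. [cite: HaitnerEtAl2020, proof of Thm. 5.1] -/
def t : UExpr := mul (mul (cst 128) M) P2X
/-- `logt`. [cite: HaitnerEtAl2020, proof of Thm. 5.1] -/
def logt : UExpr := add (add (cst 7) a) (blen X)
/-- `u`. [cite: HaitnerEtAl2020, proof of Thm. 5.1] -/
def u : UExpr := mul a P2X
/-- `Y`. [cite: HaitnerEtAl2020, proof of Thm. 5.1] -/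
def Y : UExpr := mul (mul (cst 64) M) d0
/-- `J+1`. [cite: HaitnerEtAl2020, proof of Thm. 5.1] -/
def Jp1 : UExpr := pow2 Y
/-- `aJ`. [cite: HaitnerEtAl2020, proof of Thm. 5.1] -/
def aJ : UExpr := blen Y
/-- `ℓ_j` (two variables). [cite: HaitnerEtAl2020, proof of Thm. 5.1] -/
def ell : UExpr := mul u (sub (mul (cst 2) (var 1)) (cst 5))
/-- `ℓmax`. [cite: HaitnerEtAl2020, proof of Thm. 5.1] -/
def lmax : UExpr := mul u (mul (cst 2) Jp1)
/-- `|G₂|`. [cite: HaitnerEtAl2020, proof of Thm. 5.1] -/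
def G2 : UExpr := mul lmax (add (mul t d0) (cst 1))
/-- `blk`. [cite: HaitnerEtAl2020, §4.2] -/
def blk : UExpr := add (add M lK) a
/-- `m₂`. [cite: HaitnerEtAl2020, proof of Thm. 5.1] -/
def m2 : UExpr := add (add (mul t blk) G2) lmax
/-- `n₂`. [cite: HaitnerEtAl2020, proof of Thm. 5.1] -/
def n2 : UExpr := add (mul t d0) G2
/-- `r₃`. [cite: HaitnerEtAl2020, proof of Thm. 5.1] -/
def r3 : UExpr := sub n2 (cst 1)
/-- `|G₃|`. [cite: HaitnerEtAl2020, proof of Thm. 5.1] -/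
def G3 : UExpr := mul r3 (add m2 (cst 1))
/-- `N`. [cite: HaitnerEtAl2020, proof of Thm. 5.1] -/
def N : UExpr := add n2 G3
/-- `N − 1`. [cite: HaitnerEtAl2020, proof of Thm. 5.1] -/
def Nm1 : UExpr := add r3 G3
/-- `d`. [cite: HaitnerEtAl2020, proof of Thm. 5.1] -/
def d : UExpr := add (mul Jp1 Nm1) (cst 1)
/-- `R`. [cite: HaitnerEtAl2020, Lemma 5.7] -/
def R : UExpr := sub d N
/-- `aR`. [cite: HaitnerEtAl2020, Lemma 5.7] -/
def aR : UExpr := blen R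
/-- `K`. [cite: HaitnerEtAl2020, proof of Thm. 5.1] -/
def K : UExpr := mul (mul Jp1 (add R (cst 1))) N
/-- `kLen`. [cite: HaitnerEtAl2020, proof of Thm. 5.1] -/
def kLen : UExpr := add (add (var 0) (cst 1)) K

variable (ρ : ℕ → ℕ)

/-- Bridge. [folklore] -/
@[simp] theorem a_eval : a.eval ρ = Sz.a (ρ 0) := rfl
/-- Bridge. [folklore] -/
@[simp] theorem M_eval : M.eval ρ = Sz.M (ρ 0) := rfl
/-- Bridge. [folklore] -/
@[simp] theorem lK_eval : lK.eval ρ = Sz.lK (ρ 0) := rfl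
/-- Bridge. [folklore] -/
@[simp] theorem d0_eval : d0.eval ρ = Sz.d0 (ρ 0) := rfl
/-- Bridge. [folklore] -/
@[simp] theorem X_eval : X.eval ρ = Sz.X (ρ 0) := rfl
/-- Bridge. [folklore] -/
@[simp] theorem P2X_eval : P2X.eval ρ = Sz.P2X (ρ 0) := rfl
/-- Bridge. [folklore] -/
@[simp] theorem t_eval : t.eval ρ = Sz.t (ρ 0) := rfl
/-- Bridge. [folklore] -/
@[simp] theorem logt_eval : logt.eval ρ = Sz.logt (ρ 0) := rfl
/-- Bridge. [folklore] -/
@[simp] theorem u_eval : u.eval ρ = Sz.u (ρ 0) := rfl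
/-- Bridge. [folklore] -/
@[simp] theorem Y_eval : Y.eval ρ = Sz.Y (ρ 0) := rfl
/-- Bridge. [folklore] -/
@[simp] theorem Jp1_eval : Jp1.eval ρ = Sz.Jp1 (ρ 0) := rfl
/-- Bridge. [folklore] -/
@[simp] theorem aJ_eval : aJ.eval ρ = Sz.aJ (ρ 0) := rfl
/-- Bridge. [folklore] -/
@[simp] theorem ell_eval : ell.eval ρ = Sz.ell (ρ 0) (ρ 1) := rfl
/-- Bridge. [folklore] -/
@[simp] theorem lmax_eval : lmax.eval ρ = Sz.lmax (ρ 0) := rfl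
/-- Bridge. [folklore] -/
@[simp] theorem G2_eval : G2.eval ρ = Sz.G2 (ρ 0) := rfl
/-- Bridge. [folklore] -/
@[simp] theorem blk_eval : blk.eval ρ = Sz.blk (ρ 0) := rfl
/-- Bridge. [folklore] -/
@[simp] theorem m2_eval : m2.eval ρ = Sz.m2 (ρ 0) := rfl
/-- Bridge. [folklore] -/
@[simp] theorem n2_eval : n2.eval ρ = Sz.n2 (ρ 0) := rfl
/-- Bridge. [folklore] -/
@[simp] theorem r3_eval : r3.eval ρ = Sz.r3 (ρ 0) := rfl
/-- Bridge. [folklore] -/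
@[simp] theorem G3_eval : G3.eval ρ = Sz.G3 (ρ 0) := rfl
/-- Bridge. [folklore] -/
@[simp] theorem N_eval : N.eval ρ = Sz.N (ρ 0) := rfl
/-- Bridge. [folklore] -/
@[simp] theorem Nm1_eval : Nm1.eval ρ = Sz.Nm1 (ρ 0) := rfl
/-- Bridge. [folklore] -/
@[simp] theorem d_eval : d.eval ρ = Sz.d (ρ 0) := rfl
/-- Bridge. [folklore] -/
@[simp] theorem R_eval : R.eval ρ = Sz.R (ρ 0) := rfl
/-- Bridge. [folklore] -/
@[simp] theorem aR_eval : aR.eval ρ = Sz.aR (ρ 0) := rfl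
/-- Bridge. [folklore] -/
@[simp] theorem K_eval : K.eval ρ = Sz.K (ρ 0) := rfl
/-- Bridge. [folklore] -/
@[simp] theorem kLen_eval : kLen.eval ρ = Sz.kLen (ρ 0) := rfl

end E

/-! ### Arithmetic of the table -/

/-- `n < M n = 2^{|bin n|}`. [folklore] -/
theorem lt_M (n : ℕ) : n < M n := by simpa [M, a] using bitsToNat_lt (encodeNat n)

/-- `M n ≤ 2n + 1`. [folklore] -/
theorem M_le (n : ℕ) : M n ≤ 2 * n + 1 := pow2_le (fun _ => n) (var 0)

/-- `0 < M n`. [folklore] -/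
theorem M_pos (n : ℕ) : 0 < M n := Nat.two_pow_pos _

/-- `a n ≤ n`. [folklore] -/
theorem a_le (n : ℕ) : a n ≤ n := blen_le (fun _ => n) (var 0)

/-- `a n = Nat.log 2 (M n)` (so `Nat.log 2 T = a` for `T = M`). [folklore] -/
theorem log_M (n : ℕ) : Nat.log 2 (M n) = a n := by rw [M, Nat.log_pow (by norm_num)]

/-- `X n < P2X n`. [folklore] -/
theorem X_lt_P2X (n : ℕ) : X n < P2X n := by simpa [P2X] using bitsToNat_lt (encodeNat (X n))

/-- `t n = 2^{logt n}`. [folklore] -/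
theorem t_eq_pow (n : ℕ) : t n = 2 ^ logt n := by
  rw [t, logt, M, P2X, pow_add, pow_add]; norm_num

/-- `0 < t n`. [folklore] -/
theorem t_pos (n : ℕ) : 0 < t n := by rw [t_eq_pow]; exact Nat.two_pow_pos _

/-- `t·a = 128·M·u` (`u = t a/(128 M)` exactly). [folklore] -/
theorem t_mul_a (n : ℕ) : t n * a n = 128 * M n * u n := by rw [t, u]; ring

/-- `128 M ∣ t`. [folklore] -/
theorem dvd_t (n : ℕ) : 128 * M n ∣ t n := ⟨P2X n, rfl⟩

/-- `4096·n·d₀²·M² ≤ t` (what makes `tη² ≥ n` for `η = Δ'/(4d₀)`, `Δ' = a/(16M) ≥ 1/(16M)`). [cite: HaitnerEtAl2020, proof of Thm. 5.1, Step 1] -/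
theorem t_ge (n : ℕ) : 4096 * n * (d0 n * d0 n) * (M n * M n) ≤ t n := by
  have h := X_lt_P2X n
  rw [X] at h
  rw [t]
  nlinarith [M_pos n]

/-- `n ≤ u n` for `n ≥ 1` (indeed `u = a·P2X > a·X ≥ n`). [folklore] -/
theorem le_u {n : ℕ} (hn : 1 ≤ n) : n ≤ u n := by
  have ha : 1 ≤ a n := by
    rw [a]; by_contra h; push Not at h
    have : encodeNat n = [] := List.eq_nil_of_length_eq_zero (by omega)
    have := congrArg bitsToNat this
    simp at this; omega
  have hX : n ≤ X n := by
    have hd : 1 ≤ d0 n := by have := M_pos n; unfold d0 lK; nlinarith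
    have hM := M_pos n
    have h1 : n ≤ 32 * n := by omega
    have h2 : 32 * n ≤ 32 * n * (d0 n * d0 n) := Nat.le_mul_of_pos_right _ (Nat.mul_pos hd hd)
    have h3 : 32 * n * (d0 n * d0 n) ≤ 32 * n * (d0 n * d0 n) * M n := Nat.le_mul_of_pos_right _ hM
    unfold X; omega
  have := X_lt_P2X n
  unfold u; nlinarith

/-- `Y n < Jp1 n = 2^{aJ n}`. [folklore] -/
theorem Y_lt_Jp1 (n : ℕ) : Y n < Jp1 n := by simpa [Jp1] using bitsToNat_lt (encodeNat (Y n))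

/-- `Jp1 n = 2^{aJ n}`. [folklore] -/
theorem Jp1_eq (n : ℕ) : Jp1 n = 2 ^ aJ n := rfl

/-- `1 ≤ Jp1 n`. [folklore] -/
theorem one_le_Jp1 (n : ℕ) : 1 ≤ Jp1 n := Nat.one_le_two_pow

/-- `ell n j ≤ lmax n` for grid indices `j < Jp1 n`. [folklore] -/
theorem ell_le_lmax {n j : ℕ} (hj : j < Jp1 n) : ell n j ≤ lmax n := by
  unfold ell lmax; exact Nat.mul_le_mul_left _ (by omega)

/-- `1 ≤ d0 n`. [folklore] -/
theorem one_le_d0 (n : ℕ) : 1 ≤ d0 n := by have := M_pos n; unfold d0 lK; nlinarith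

/-- `1 ≤ n2 n`. [folklore] -/
theorem one_le_n2 (n : ℕ) : 1 ≤ n2 n := by
  have := one_le_d0 n; have := t_pos n; unfold n2; nlinarith

/-- `r3 n + 1 = n2 n`. [folklore] -/
theorem r3_add_one (n : ℕ) : r3 n + 1 = n2 n := by have := one_le_n2 n; unfold r3; omega

/-- `Nm1 n + 1 = N n`. [folklore] -/
theorem Nm1_add_one (n : ℕ) : Nm1 n + 1 = N n := by rw [Nm1, N, ← r3_add_one]; ring

/-- `N n ≤ d n`. [folklore] -/
theorem N_le_d (n : ℕ) : N n ≤ d n := by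
  rw [d, ← Nm1_add_one]; have := one_le_Jp1 n; nlinarith

/-- `d n = N n + R n`. [folklore] -/
theorem d_eq (n : ℕ) : d n = N n + R n := by have := N_le_d n; unfold R; omega

/-- The output length: `Jp1·(N − 1) = d − 1`, `Jp1·(N − 1) + 1 = d`. [cite: HaitnerEtAl2020, Lemma 5.7 and Step 5] -/
theorem Jp1_mul_Nm1 (n : ℕ) : Jp1 n * Nm1 n + 1 = d n := rfl

/-- `R n = (Jp1 n − 1)·Nm1 n`. [folklore] -/
theorem R_eq (n : ℕ) : R n = (Jp1 n - 1) * Nm1 n := by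
  have h1 := one_le_Jp1 n
  have h2 := Nm1_add_one n
  unfold R d
  rw [← h2, Nat.sub_mul, one_mul]
  have : Nm1 n ≤ Jp1 n * Nm1 n := by nlinarith
  omega

/-- `R n < 2^{aR n}`. [folklore] -/
theorem R_lt (n : ℕ) : R n < 2 ^ aR n := by simpa [aR] using bitsToNat_lt (encodeNat (R n))

/-- `kLen` is strictly monotone in its key part: `n < kLen n` and `kLen` injective suffices for us;
here `n + 1 ≤ kLen n`. [folklore] -/
theorem lt_kLen (n : ℕ) : n < kLen n := by unfold kLen; omega

/-! ### Polynomial bounds -/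

/-- Every table entry is polynomially bounded (instance: the index length). [folklore] -/
theorem exists_poly_kLen : ∃ p : Polynomial ℕ, ∀ n, kLen n ≤ p.eval n := by
  obtain ⟨p, hp⟩ := exists_poly_le₁ E.kLen
  exact ⟨p, fun n => by simpa using hp n⟩

/-- The input length is polynomially bounded. [folklore] -/
theorem exists_poly_d : ∃ p : Polynomial ℕ, ∀ n, d n ≤ p.eval n := by
  obtain ⟨p, hp⟩ := exists_poly_le₁ E.d
  exact ⟨p, fun n => by simpa using hp n⟩

end Sz

end HHRVW

end Literature.Computability.Cryptography
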